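import Mathlib
import Summits.Ventures.PercRepro2.Defs
import Summits.Ventures.PercRepro2.Independence
import Summits.Ventures.PercRepro2.Harris
import Summits.Ventures.PercRepro2.Graph
import Summits.Ventures.PercRepro2.Events
import Summits.Ventures.PercRepro2.BoxUnionDefs
import Summits.Ventures.PercRepro2.BoxUnion
import Summits.Ventures.PercRepro2.BoxUnionPair

/-!
# Log-supermodularity is inherited by lattice-homomorphic images; the status laws on every
observed set inherit it from the full two-cluster law (blind cell PercRepro2, mine-1 g38;
proofs/MINE1-ZLSM.md §3 (α))

**Lemma** (`pushforward_lsm`, Ahlswede–Daykin): if `ν ≥ 0` is log-supermodular on a finite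
distributive lattice `α` and `φ : α → β` preserves `⊓` and `⊔`, the image measure
`b ↦ ∑_{φ x = b} ν x` is log-supermodular on `β`.  (Apply the four functions theorem to
`ν·1_{φ = b}`, `ν·1_{φ = b'}`, `ν·1_{φ = b ⊓ b'}`, `ν·1_{φ = b ⊔ b'}`.)

**Application.** The status pair on an observed set `F` is the image of the full cluster pair
under the lattice homomorphism `(W, C) ↦ (W ∩ F, C ∩ F)` of the (Z)-lattice
`ZLat V = Finset V × (Finset V)ᵒᵈ` (`status_eq_restrictZ`), so the status law on `F` is the
image of the full two-cluster law (`pairLaw_eq_pushforward`) and inherits log-supermodularity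
(`pairLaw_lsm_of_univ`): the class of observed sets on which the status law is log-supermodular
is closed downwards.  Consequently the union-row theorem of `BoxUnionPair` holds for EVERY
observed set `F ⊇ X ∪ Y` under the single hypothesis that the FULL two-cluster law is
log-supermodular (`hit_boxUnion_nonneg_of_univ_lsm`).
-/

namespace Summit.Ventures.PercRepro2

namespace BoxUnionPair

open Finset

/-! ### The abstract lemma -/

section Pushforward

variable {α β : Type*} [DistribLattice α] [Fintype α] [Lattice β] [DecidableEq β]

/-- The image of a weight `ν` on `α` under a map `φ : α → β`: `b ↦ ∑_{φ x = b} ν x`. -/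
def pushforward (φ : α → β) (ν : α → ℝ) (b : β) : ℝ := ∑ x, if φ x = b then ν x else 0

omit [DistribLattice α] [Lattice β] in
/-- The image weight is nonnegative. -/
lemma pushforward_nonneg (φ : α → β) {ν : α → ℝ} (hν : ∀ x, 0 ≤ ν x) (b : β) :
    0 ≤ pushforward φ ν b :=
  sum_nonneg fun x _ => ite_nonneg (hν x) le_rfl

/-- **Log-supermodularity is inherited by lattice-homomorphic images** (Ahlswede–Daykin). -/
theorem pushforward_lsm {φ : α → β} (hinf : ∀ x y, φ (x ⊓ y) = φ x ⊓ φ y)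
    (hsup : ∀ x y, φ (x ⊔ y) = φ x ⊔ φ y) {ν : α → ℝ} (hν : ∀ x, 0 ≤ ν x)
    (hlsm : ∀ x y, ν x * ν y ≤ ν (x ⊓ y) * ν (x ⊔ y)) (b b' : β) :
    pushforward φ ν b * pushforward φ ν b' ≤
      pushforward φ ν (b ⊓ b') * pushforward φ ν (b ⊔ b') := by
  unfold pushforward
  refine four_functions_theorem_univ (fun x => if φ x = b then ν x else 0)
    (fun x => if φ x = b' then ν x else 0) (fun x => if φ x = b ⊓ b' then ν x else 0)
    (fun x => if φ x = b ⊔ b' then ν x else 0)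
    (fun x => ite_nonneg (hν x) le_rfl) (fun x => ite_nonneg (hν x) le_rfl)
    (fun x => ite_nonneg (hν x) le_rfl) (fun x => ite_nonneg (hν x) le_rfl) (fun x y => ?_)
  by_cases hx : φ x = b
  · by_cases hy : φ y = b'
    · rw [if_pos hx, if_pos hy, if_pos (by rw [hinf, hx, hy]), if_pos (by rw [hsup, hx, hy])]
      exact hlsm x y
    · rw [if_neg hy, mul_zero]
      exact mul_nonneg (ite_nonneg (hν _) le_rfl) (ite_nonneg (hν _) le_rfl)
  · rw [if_neg hx, zero_mul]
    exact mul_nonneg (ite_nonneg (hν _) le_rfl) (ite_nonneg (hν _) le_rfl)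

end Pushforward

/-! ### The status map is a lattice homomorphism of the (Z)-lattice -/

section Status

open scoped Classical

variable {V : Type*} {E : Type*} [Fintype V] [DecidableEq V] [Fintype E] [DecidableEq E]

/-- Restriction of a cluster pair to the observed set `F`: `(W, C) ↦ (W ∩ F, C ∩ F)`. -/
def restrictZ (F : Finset V) (k : ZLat V) : ZLat V :=
  (k.1 ∩ F, OrderDual.toDual (OrderDual.ofDual k.2 ∩ F))

omit [Fintype V] [Fintype E] [DecidableEq E] in
/-- `restrictZ F` preserves meets. -/
lemma restrictZ_inf (F : Finset V) (k k' : ZLat V) :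
    restrictZ F (k ⊓ k') = restrictZ F k ⊓ restrictZ F k' := by
  unfold restrictZ
  refine Prod.ext ?_ ?_
  · simp only [Prod.fst_inf]
    exact Finset.inter_inter_distrib_right _ _ _
  · simp only [Prod.snd_inf]
    change OrderDual.toDual ((OrderDual.ofDual k.2 ∪ OrderDual.ofDual k'.2) ∩ F) =
      OrderDual.toDual (OrderDual.ofDual k.2 ∩ F ∪ OrderDual.ofDual k'.2 ∩ F)
    rw [Finset.union_inter_distrib_right]

omit [Fintype V] [Fintype E] [DecidableEq E] in
/-- `restrictZ F` preserves joins. -/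
lemma restrictZ_sup (F : Finset V) (k k' : ZLat V) :
    restrictZ F (k ⊔ k') = restrictZ F k ⊔ restrictZ F k' := by
  unfold restrictZ
  refine Prod.ext ?_ ?_
  · simp only [Prod.fst_sup]
    exact Finset.union_inter_distrib_right _ _ _
  · simp only [Prod.snd_sup]
    change OrderDual.toDual ((OrderDual.ofDual k.2 ∩ OrderDual.ofDual k'.2) ∩ F) =
      OrderDual.toDual (OrderDual.ofDual k.2 ∩ F ∩ (OrderDual.ofDual k'.2 ∩ F))
    rw [Finset.inter_inter_distrib_right]

omit [DecidableEq E] in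
/-- The status on `F` is the restriction of the full cluster pair. -/
lemma status_eq_restrictZ (ends : E → Sym2 V) (F : Finset V) (s t : V) (ω : Config E) :
    status ends F s t ω = restrictZ F (status ends univ s t ω) := by
  unfold status restrictZ
  refine Prod.ext ?_ ?_
  · simp only
    rw [Finset.filter_inter, Finset.univ_inter]
  · simp only
    change OrderDual.toDual (F.filter (fun u => Conn ends ω t u)) =
      OrderDual.toDual (Finset.univ.filter (fun u => Conn ends ω t u) ∩ F)
    rw [Finset.filter_inter, Finset.univ_inter]

variable {p : E → ℝ} (ends : E → Sym2 V) (F : Finset V) (s t : V)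

/-- The status law on `F` is the image of the full two-cluster law under `restrictZ F`. -/
lemma pairLaw_eq_pushforward (k : ZLat V) :
    pairLaw p ends F s t k = pushforward (restrictZ F) (pairLaw p ends univ s t) k := by
  unfold pushforward pairLaw
  have hpush : ∀ x : ZLat V,
      (if restrictZ F x = k then
        ∑ ω, (if status ends univ s t ω = x ∧ ω ∈ (connEvent ends s t)ᶜ then weight p ω else 0)
      else 0) =
      ∑ ω, if restrictZ F x = k ∧ status ends univ s t ω = x ∧ ω ∈ (connEvent ends s t)ᶜ then
        weight p ω else 0 := by
    intro x
    split_ifs with h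
    · refine Finset.sum_congr rfl fun ω _ => ?_
      simp only [h, true_and]
    · simp only [h, false_and, if_false, Finset.sum_const_zero]
  rw [Finset.sum_congr rfl fun x _ => hpush x, Finset.sum_comm]
  refine Finset.sum_congr rfl fun ω _ => ?_
  rw [status_eq_restrictZ]
  by_cases hQ : ω ∈ (connEvent ends s t)ᶜ
  · simp only [hQ, and_true]
    rw [Finset.sum_eq_single (status ends univ s t ω)]
    · simp only [and_true]
    · intro x _ hx
      rw [if_neg (fun h => hx h.2.symm)]
    · intro h
      exact absurd (Finset.mem_univ _) h
  · simp only [hQ, and_false, if_false, Finset.sum_const_zero]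

/-- **Down-closure.** If the full two-cluster law is log-supermodular on the (Z)-lattice, so is
the status law on every observed set `F`. -/
theorem pairLaw_lsm_of_univ (hp : IsProbVec p)
    (hlsm : ∀ x y : ZLat V, pairLaw p ends univ s t x * pairLaw p ends univ s t y ≤
      pairLaw p ends univ s t (x ⊓ y) * pairLaw p ends univ s t (x ⊔ y)) (x y : ZLat V) :
    pairLaw p ends F s t x * pairLaw p ends F s t y ≤
      pairLaw p ends F s t (x ⊓ y) * pairLaw p ends F s t (x ⊔ y) := by
  simp only [pairLaw_eq_pushforward]
  exact pushforward_lsm (restrictZ_inf F) (restrictZ_sup F)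
    (pairLaw_nonneg ends univ s t hp) hlsm x y

/-- **The union row on every observed set from the full-law hypothesis**: if the law of
`(C_s, C_t)` on `{s ↮ t}` is log-supermodular on the (Z)-lattice, then for every `F ⊇ X ∪ Y`
and all `f g` increasing in `C_s ∩ F` and decreasing in `C_t ∩ F`,
`E[(f(σ_F) − E[f(σ_F) | Q]) (g(σ_F) − E[g(σ_F) | Q]) · 1_{Q ∩ ({s ↮ X} ∪ {t ↮ Y})}] ≥ 0`. -/
theorem hit_boxUnion_nonneg_of_univ_lsm (hp : IsProbVec p)
    (hlsm : ∀ x y : ZLat V, pairLaw p ends univ s t x * pairLaw p ends univ s t y ≤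
      pairLaw p ends univ s t (x ⊓ y) * pairLaw p ends univ s t (x ⊔ y))
    (hQ : 0 < prob p (connEvent ends s t)ᶜ) {f g : Finset V → Finset V → ℝ}
    (hf : ∀ ⦃W W' C C' : Finset V⦄, W ⊆ W' → C' ⊆ C → f W C ≤ f W' C')
    (hg : ∀ ⦃W W' C C' : Finset V⦄, W ⊆ W' → C' ⊆ C → g W C ≤ g W' C')
    {X Y : Finset V} (hX : X ⊆ F) (hY : Y ⊆ F) :
    0 ≤ expect p (((connEvent ends s t)ᶜ ∩ ((hitEvent ends s X)ᶜ ∪ (hitEvent ends t Y)ᶜ)).indicator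
      (fun ω =>
        (f (status ends F s t ω).1 (OrderDual.ofDual (status ends F s t ω).2) -
            condMean p ends F s t (fun k => f k.1 (OrderDual.ofDual k.2))) *
          (g (status ends F s t ω).1 (OrderDual.ofDual (status ends F s t ω).2) -
            condMean p ends F s t (fun k => g k.1 (OrderDual.ofDual k.2))))) :=
  hit_boxUnion_nonneg ends F s t hp (pairLaw_lsm_of_univ ends F s t hp hlsm) hQ hf hg hX hY

end Status

end BoxUnionPair

end Summit.Ventures.PercRepro2
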